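import Mathlib.LinearAlgebra.FreeModule.IdealQuotient
import Mathlib.RingTheory.DedekindDomain.IntegralClosure
import Mathlib.RingTheory.Ideal.GoingUp
import Literature.AnabelianGeometry.EtaleTheta.LogDivisorModelTateTowerArithmeticProp32iii

/-!
# [EtTh] Prop. 3.2 (iii) in PRINT'S OWN CASE: the constant field `L` is an arbitrary finite extension of `ℚ_p`

S. Mochizuki, *The étale theta function …*, Publ. RIMS **45** (2009) [MochizukiEtTh2009], §3 Prop. 3.2 (iii) (PRIMS
PDF p.70; print: "follows from the well-known structure of `O_L^×`", `L` a finite extension of `ℚ_p`)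
[cite: MochizukiEtTh2009, Prop 3.2 p.70].  abc-iut cell, seat abc-iut-f-123 gen 7; PROOF-ONLY companion (0 `def`, 0
`instance`, 0 notation) to `LogDivisorModelTateTowerArithmeticProp32iii.lean` (p474682, seat w5-d223: the generic
Krull-intersection theorem `DedekindDivisible.units_eq_one_of_finite_quotients` and the instance `L = ℚ_p`).  The ONE
residual that file displays (ruling R781 of the L2 book: "the general finite `L/ℚ_p` instance — presentation of `𝓞_L`
as a Dedekind domain with finite quotients") is discharged HERE from Mathlib:
* §1 `PIDDivisible.finite_quotient_of_ne_bot` — over a PID `A` all of whose proper principal quotients `A ⧸ (a)`,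
  `a ≠ 0`, are finite, every nonzero ideal of the integral closure `C` of `A` in a finite separable extension `L` of
  `K = Frac A` has a finite quotient `C ⧸ I` (Smith normal form of `I` in the free `A`-module `C`:
  `Ideal.quotientEquivPiSpan`, `IsIntegralClosure.module_free` / `.finite`);
* §1 `PIDDivisible.exists_heightOneSpectrum` — `C` has a nonzero prime (a maximal ideal over the one of `A`, going-up);
* §1 **`PIDDivisible.units_eq_one_of_forall_exists_pow_eq`** — hence an infinitely divisible `c ∈ L^×` is `1`
  (`DedekindDivisible.units_eq_one_of_finite_quotients` at `C`, `integralClosure.isDedekindDomain`);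
* §2 `MLFDivisible.finite_quotient_span_singleton` — `ℤ_[p] ⧸ (a)` is finite for `a ≠ 0` (`a ~ pⁿ`, DVR);
* §2 **`MLFDivisible.units_eq_one_of_forall_exists_pow_eq : ∀ (L) [Field L] [Algebra ℚ_[p] L]
  [FiniteDimensional ℚ_[p] L] (c : Lˣ), (∀ N ≥ 1, ∃ d, d ^ N = c) → c = 1`** — Prop. 3.2 (iii) VERBATIM for every
  finite extension `L` of `ℚ_p`, i.e. the shape of the `Datum.eq_one_of_divisible` field and of the binder `hK`
  ("`⋂_N (K′^×)^N = 1`") of the Thm. 5.7 knit `…_final_v6` (p476561) at any MLF constant field.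
Classical lemmas print assumes; no new Prop-valued fact.  HONEST FRAMING: supporting number theory for the typed
[EtTh] §3 interfaces; nothing of [EtTh] beyond Prop. 3.2 (iii) asserted; nothing here bears on [IUTchIII] Cor. 3.12;
no side taken; typed ≠ proved elsewhere.
-/

noncomputable section

namespace Literature.AnabelianGeometry.EtaleTheta

open IsDedekindDomain

/-! ### §1. Integral closures of PIDs with finite principal quotients -/

namespace PIDDivisible

variable (A : Type*) [CommRing A] [IsDomain A] [IsPrincipalIdealRing A]
  (K : Type*) [Field K] [Algebra A K] [IsFractionRing A K]
  (L : Type*) [Field L] [Algebra K L] [Algebra A L] [IsScalarTower A K L]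
  [FiniteDimensional K L] [Algebra.IsSeparable K L]

include K

/-- Over a PID `A` whose proper principal quotients are finite, every nonzero ideal `I` of the integral closure `C`
of `A` in a finite separable extension `L ⊇ Frac A` has finite quotient `C ⧸ I` (Smith normal form).
[cite: MochizukiEtTh2009, Prop 3.2 p.70] -/
theorem finite_quotient_of_ne_bot (hA : ∀ a : A, a ≠ 0 → Finite (A ⧸ Ideal.span ({a} : Set A)))
    (I : Ideal (integralClosure A L)) (hI : I ≠ ⊥) : Finite (integralClosure A L ⧸ I) := by
  haveI : Module.IsTorsionFree A L := .trans_faithfulSMul A K L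
  haveI : Module.Free A (integralClosure A L) :=
    IsIntegralClosure.module_free A K L (integralClosure A L)
  haveI : Module.Finite A (integralClosure A L) := IsIntegralClosure.finite A K L (integralClosure A L)
  let b := Module.Free.chooseBasis A (integralClosure A L)
  let e := I.quotientEquivPiSpan b hI
  haveI : ∀ i, Finite (A ⧸ Ideal.span ({I.smithCoeffs b hI i} : Set A)) := fun i =>
    hA _ (Ideal.smithCoeffs_ne_zero b I hI i)
  exact Finite.of_equiv _ e.toEquiv.symm

omit [IsDomain A] [IsPrincipalIdealRing A] [FiniteDimensional K L] [Algebra.IsSeparable K L] in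
/-- The integral closure `C` of a domain `A` that is not a field, in an extension field `L ⊇ Frac A`, has a nonzero
prime: `C` is integral over `A`, hence not a field, so any maximal ideal of `C` is nonzero.
[cite: MochizukiEtTh2009, Def 3.1 p.70] -/
theorem exists_heightOneSpectrum (hAf : ¬ IsField A) : Nonempty (HeightOneSpectrum (integralClosure A L)) := by
  have hinjL : Function.Injective (algebraMap A L) := by
    rw [IsScalarTower.algebraMap_eq A K L]
    exact (algebraMap K L).injective.comp (IsFractionRing.injective A K)
  have hinj : Function.Injective (algebraMap A (integralClosure A L)) := by
    intro x y hxy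
    apply hinjL
    have := congrArg (algebraMap (integralClosure A L) L) hxy
    rwa [← IsScalarTower.algebraMap_apply A (integralClosure A L) L,
      ← IsScalarTower.algebraMap_apply A (integralClosure A L) L] at this
  have hCf : ¬ IsField (integralClosure A L) := fun hf =>
    hAf (((IsIntegralClosure.isIntegral_algebra A L).isField_iff_isField hinj).mpr hf)
  obtain ⟨M, hM⟩ := Ideal.exists_maximal (integralClosure A L)
  exact ⟨⟨M, hM.isPrime, Ring.ne_bot_of_isMaximal_of_not_isField hM hCf⟩⟩

/-- **Prop. 3.2 (iii) over a PID with finite principal quotients**: if `A` is a PID, not a field, with `A ⧸ (a)`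
finite for every `a ≠ 0`, and `L` is a finite separable extension of `Frac A`, then an element of `L^×` admitting an
`N`-th root for every `N ≥ 1` is `1` (Krull intersection in the Dedekind domain `𝓞_L = C`).
[cite: MochizukiEtTh2009, Prop 3.2 p.70] -/
theorem units_eq_one_of_forall_exists_pow_eq (hA : ∀ a : A, a ≠ 0 → Finite (A ⧸ Ideal.span ({a} : Set A)))
    (hAf : ¬ IsField A) (c : Lˣ) (h : ∀ N : ℕ+, ∃ d : Lˣ, d ^ (N : ℕ) = c) : c = 1 := by
  haveI : IsDedekindDomain (integralClosure A L) := integralClosure.isDedekindDomain A K L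
  haveI : IsFractionRing (integralClosure A L) L := integralClosure.isFractionRing_of_finite_extension K L
  obtain ⟨P⟩ := exists_heightOneSpectrum A K L hAf
  exact DedekindDivisible.units_eq_one_of_finite_quotients P
    (fun k => finite_quotient_of_ne_bot A K L hA _ (pow_ne_zero k P.ne_bot)) c h

end PIDDivisible

/-! ### §2. The MLF case: `L` any finite extension of `ℚ_p` -/

namespace MLFDivisible

variable (p : ℕ) [Fact p.Prime]

/-- `ℤ_[p] ⧸ (a)` is finite for `a ≠ 0`: `a` is associated to `pⁿ`, and `ℤ_[p] ⧸ (p)ⁿ ≅ ℤ/pⁿ`.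
[cite: MochizukiEtTh2009, Prop 3.2 p.70] -/
theorem finite_quotient_span_singleton (a : ℤ_[p]) (ha : a ≠ 0) :
    Finite (ℤ_[p] ⧸ Ideal.span ({a} : Set ℤ_[p])) := by
  obtain ⟨n, hn⟩ := IsDiscreteValuationRing.associated_pow_irreducible ha (PadicInt.irreducible_p (p := p))
  have hspan : Ideal.span ({a} : Set ℤ_[p]) = (PadicDivisible.primeSpec p).asIdeal ^ n := by
    rw [Ideal.span_singleton_eq_span_singleton.mpr hn, ← Ideal.span_singleton_pow]
    change Ideal.span {(p : ℤ_[p])} ^ n = IsLocalRing.maximalIdeal ℤ_[p] ^ n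
    rw [PadicInt.maximalIdeal_eq_span_p]
  haveI := PadicDivisible.finite_quotient_primeSpec_pow p n
  exact Finite.of_equiv _ (Ideal.quotEquivOfEq hspan).toEquiv.symm

/-- **`𝓞_L` is a Dedekind domain**: the integral closure of `ℤ_[p]` in a finite extension `L` of `ℚ_p` (for any
`ℤ_[p]`-algebra structure on `L` through `ℚ_[p]`). [cite: MochizukiEtTh2009, Def 3.1 p.70] -/
theorem isDedekindDomain_integralClosure (L : Type*) [Field L] [Algebra ℚ_[p] L] [FiniteDimensional ℚ_[p] L]
    [Algebra ℤ_[p] L] [IsScalarTower ℤ_[p] ℚ_[p] L] : IsDedekindDomain (integralClosure ℤ_[p] L) :=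
  integralClosure.isDedekindDomain ℤ_[p] ℚ_[p] L

/-- **`𝓞_L` has finite quotients**: for `L` a finite extension of `ℚ_p`, every nonzero ideal `I` of the integral
closure `𝓞_L` of `ℤ_[p]` in `L` has finite residue ring `𝓞_L ⧸ I` (in particular all `𝓞_L ⧸ Pᵏ`). This is the
"presentation of `𝓞_L` as a Dedekind domain with finite quotients" consumed by
`DedekindDivisible.units_eq_one_of_finite_quotients`. [cite: MochizukiEtTh2009, Prop 3.2 p.70] -/
theorem finite_quotient_integralClosure_of_ne_bot (L : Type*) [Field L] [Algebra ℚ_[p] L]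
    [FiniteDimensional ℚ_[p] L] [Algebra ℤ_[p] L] [IsScalarTower ℤ_[p] ℚ_[p] L]
    (I : Ideal (integralClosure ℤ_[p] L)) (hI : I ≠ ⊥) : Finite (integralClosure ℤ_[p] L ⧸ I) :=
  PIDDivisible.finite_quotient_of_ne_bot ℤ_[p] ℚ_[p] L (finite_quotient_span_singleton p) I hI

/-- `𝓞_L` has a nonzero prime (it is not a field), `L` a finite extension of `ℚ_p`.
[cite: MochizukiEtTh2009, Def 3.1 p.70] -/
theorem nonempty_heightOneSpectrum_integralClosure (L : Type*) [Field L] [Algebra ℚ_[p] L]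
    [FiniteDimensional ℚ_[p] L] [Algebra ℤ_[p] L] [IsScalarTower ℤ_[p] ℚ_[p] L] :
    Nonempty (HeightOneSpectrum (integralClosure ℤ_[p] L)) :=
  PIDDivisible.exists_heightOneSpectrum ℤ_[p] ℚ_[p] L (IsDiscreteValuationRing.not_isField ℤ_[p])

/-- **Prop. 3.2 (iii) for every finite extension `L` of the MLF `ℚ_p`** (print's case): an element of `L^×`
admitting an `N`-th root for every `N ≥ 1` is `1`.  (`𝓞_L :=` the integral closure of `ℤ_[p]` in `L` is a Dedekind
domain with finite residue rings; Krull intersection.) [cite: MochizukiEtTh2009, Prop 3.2 p.70] -/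
theorem units_eq_one_of_forall_exists_pow_eq (L : Type*) [Field L] [Algebra ℚ_[p] L] [FiniteDimensional ℚ_[p] L]
    (c : Lˣ) (h : ∀ N : ℕ+, ∃ d : Lˣ, d ^ (N : ℕ) = c) : c = 1 := by
  letI : Algebra ℤ_[p] L := ((algebraMap ℚ_[p] L).comp (algebraMap ℤ_[p] ℚ_[p])).toAlgebra
  haveI : IsScalarTower ℤ_[p] ℚ_[p] L := IsScalarTower.of_algebraMap_eq (fun _ => rfl)
  exact PIDDivisible.units_eq_one_of_forall_exists_pow_eq ℤ_[p] ℚ_[p] L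
    (finite_quotient_span_singleton p) (IsDiscreteValuationRing.not_isField ℤ_[p]) c h

/-- Pointwise form of Prop. 3.2 (iii) over a finite extension `L` of `ℚ_p`: if `c ∈ L` is nonzero and has an `N`-th
root in `L` for every `N ≥ 1`, then `c = 1`. [cite: MochizukiEtTh2009, Prop 3.2 p.70] -/
theorem eq_one_of_forall_exists_pow_eq (L : Type*) [Field L] [Algebra ℚ_[p] L] [FiniteDimensional ℚ_[p] L]
    (c : L) (hc : c ≠ 0) (h : ∀ N : ℕ+, ∃ d : L, d ^ (N : ℕ) = c) : c = 1 := by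
  have key := units_eq_one_of_forall_exists_pow_eq p L (Units.mk0 c hc) (fun N => by
    obtain ⟨d, hd⟩ := h N
    have hd0 : d ≠ 0 := by
      rintro rfl
      rw [zero_pow (PNat.ne_zero N)] at hd
      exact hc hd.symm
    exact ⟨Units.mk0 d hd0, Units.ext (by simpa using hd)⟩)
  simpa using congrArg (fun u : Lˣ => (u : L)) key

end MLFDivisible

end Literature.AnabelianGeometry.EtaleTheta

end
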